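import Mathlib
import Literature.Analysis.Complex.CauchyPompeiu
import Literature.Analysis.Complex.CauchyTransform
import Literature.Analysis.Complex.CauchyTransformBounds
import Literature.Analysis.Complex.WeylLemmaDbar
import Literature.Analysis.Complex.Montel
import Literature.Topology.PlaneTopology.WindingNumber
import Summits.SmoothPoincare4.SmoothPoincare4.Theorems.SullivanDualTameOrBrodyR4HelperRegularisedCoefficient
import Summits.SmoothPoincare4.SmoothPoincare4.Theorems.SullivanDualTameOrBrodyR4HelperApproxHolomorphic
import Summits.SmoothPoincare4.SmoothPoincare4.Theorems.SullivanDualTameOrBrodyR4HelperWindNeZeroOfZero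
import Summits.SmoothPoincare4.SmoothPoincare4.Theorems.SullivanDualTameOrBrodyR4HelperZeroFreeOfDbarLe

/-!
# Local similarity principle: isolated zeros of positive index (stub
`helper_localZeroIsolatedPositive`, line Sketch)

Crux `stmt-SmoothPoincare4-7826` (`TameOrBrodyR4`), line `Sketch`: local consequences of the
Carleman similarity principle, obtained with the `δ`-regularisation + Montel trick instead of
Sobolev theory. Let `w : ℂ → ℂ` be smooth with `∂̄ w = r` and `‖r‖ ≤ M ‖w‖` on the closed disc
`‖η‖ ≤ ρ`, `w z₀ = 0` at an interior point, `w` not identically zero on the open disc. Then `z₀`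
is an isolated zero of `w` and the winding number of `w` along small circles around `z₀` is
non-zero.

Proof. Localise the coefficient with a cut-off `χ` (`= 1` on `‖η‖ ≤ ρ''`, supported in
`‖η‖ < ρ`): `r̃ = χ r` satisfies `‖r̃‖ ≤ M ‖w‖` everywhere and vanishes for `‖η‖ ≥ ρ`. For
`δ = t² > 0` the regularised coefficient `a = r̃ w̄ / (|w|² + δ)` (`‖a‖ ≤ M`,
`‖r̃ - a w‖ ≤ M t / 2`, `helper_regularisedCoefficient`) has a smooth Cauchy transform `s`
(`∂̄ s = a`, `‖s‖ ≤ S`), and `h = e^{-s} w` satisfies `‖∂̄ h‖ = ‖e^{-s} (r - a w)‖ ≤ e^S M t / 2`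
on `‖η‖ ≤ ρ''` (where `r = r̃`), so (`helper_approxHolomorphic`) there is `H_t` holomorphic on
`‖η‖ < ρ'` with `‖h - H_t‖ ≤ C e^S M t / 2` on `‖η‖ ≤ ρ'`. The family `(H_t)` is uniformly
bounded; by Montel a subsequence `t → 0` converges locally uniformly to a holomorphic `H` with
`e^{-S} ‖w‖ ≤ ‖H‖ ≤ e^S ‖w‖` on `‖η‖ < ρ'`. Hence `H` and `w` have the same zeros there, `H`
is not identically zero, and the identity theorem makes `z₀` an isolated zero of `H`, hence of
`w`. Along a small circle `γ` around `z₀` the argument principle (`helper_windNeZeroOfZero`,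
after a translation) gives `wind (H ∘ γ) ≠ 0`, and two applications of Rouché
(`H_t ∘ γ → H ∘ γ` uniformly, `‖h ∘ γ - H_t ∘ γ‖ → 0`, `wind (h ∘ γ) = wind (w ∘ γ)` because
`e^{-s ∘ γ}` is the exponential of a periodic function) transfer this to `wind (w ∘ γ) ≠ 0`.
-/

set_option linter.dupNamespace false

noncomputable section

open scoped ContDiff Topology
open Filter Set Metric
open Literature.Analysis.Complex Literature.Topology.PlaneTopology

namespace Summit.SmoothPoincare4.SmoothPoincare4.Cruxes.TameOrBrodyR4.Sketch

namespace LocalZeroIsolatedPositive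

open ZeroFreeOfDbarLe

/-! ### Passing two-sided bounds to a limit -/

/-- If `u k → L`, `‖v k - u k‖ ≤ e k` with `e k → 0`, and `lo ≤ ‖v k‖ ≤ hi` for all `k`, then
`lo ≤ ‖L‖ ≤ hi`. -/
theorem norm_le_of_tendsto {u v : ℕ → ℂ} {L : ℂ} {e : ℕ → ℝ} {lo hi : ℝ}
    (hu : Tendsto u atTop (𝓝 L)) (he : Tendsto e atTop (𝓝 0))
    (hclose : ∀ k, ‖v k - u k‖ ≤ e k) (hlo : ∀ k, lo ≤ ‖v k‖) (hhi : ∀ k, ‖v k‖ ≤ hi) :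
    lo ≤ ‖L‖ ∧ ‖L‖ ≤ hi := by
  have hn : Tendsto (fun k => ‖u k‖) atTop (𝓝 ‖L‖) := hu.norm
  constructor
  · have h1 : Tendsto (fun k => lo - e k) atTop (𝓝 (lo - 0)) := tendsto_const_nhds.sub he
    rw [sub_zero] at h1
    refine le_of_tendsto_of_tendsto' h1 hn fun k => ?_
    have := norm_sub_norm_le (v k) (u k)
    linarith [hclose k, hlo k]
  · have h1 : Tendsto (fun k => hi + e k) atTop (𝓝 (hi + 0)) := tendsto_const_nhds.add he
    rw [add_zero] at h1
    refine le_of_tendsto_of_tendsto' hn h1 fun k => ?_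
    have := norm_sub_norm_le (u k) (v k)
    rw [norm_sub_rev] at this
    linarith [hclose k, hhi k]

/-! ### Isolated zeros of the holomorphic limit -/

/-- A function holomorphic on the disc `‖z‖ < ρ'` and not vanishing at some point `z₁` of the disc
is zero-free on a small punctured closed disc `0 < ‖z - z₀‖ ≤ ε` around any point `z₀` of the
disc, with `‖z₀‖ + ε < ρ'` (identity theorem on the connected disc + isolated zeros). -/
theorem exists_radius {H : ℂ → ℂ} {ρ' : ℝ} (hH : DifferentiableOn ℂ H (ball 0 ρ')) {z₀ z₁ : ℂ}
    (hz₀ : ‖z₀‖ < ρ') (hz₁ : ‖z₁‖ < ρ') (h1 : H z₁ ≠ 0) :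
    ∃ ε : ℝ, 0 < ε ∧ ‖z₀‖ + ε < ρ' ∧ ∀ z : ℂ, 0 < ‖z - z₀‖ → ‖z - z₀‖ ≤ ε → H z ≠ 0 := by
  have hA : AnalyticOnNhd ℂ H (ball 0 ρ') := hH.analyticOnNhd isOpen_ball
  have hev : ∀ᶠ z in 𝓝[≠] z₀, H z ≠ 0 := by
    rcases (hA z₀ (mem_ball_zero_iff.2 hz₀)).eventually_eq_zero_or_eventually_ne_zero with h | h
    · exact absurd (hA.eqOn_zero_of_preconnected_of_eventuallyEq_zero
        (convex_ball 0 ρ').isPreconnected (mem_ball_zero_iff.2 hz₀) h (mem_ball_zero_iff.2 hz₁)) h1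
    · exact h
  obtain ⟨ε₁, hε₁, hε₁'⟩ := Metric.eventually_nhds_iff.1 (eventually_nhdsWithin_iff.1 hev)
  refine ⟨min (ε₁ / 2) ((ρ' - ‖z₀‖) / 2), lt_min (by linarith) (by linarith), ?_, ?_⟩
  · have := min_le_right (ε₁ / 2) ((ρ' - ‖z₀‖) / 2)
    linarith
  · intro z hz hzε
    have hlt : dist z z₀ < ε₁ := by
      rw [dist_eq_norm]
      have := min_le_left (ε₁ / 2) ((ρ' - ‖z₀‖) / 2)
      linarith
    exact hε₁' hlt (mem_compl_singleton_iff.2 (sub_ne_zero.1 (norm_pos_iff.1 hz)))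

/-! ### The argument principle around `z₀` -/

/-- **Argument principle, translated.** If `H` is holomorphic on `‖z‖ < ρ'`, vanishes at `z₀`
and has no zero on the circle `‖z - z₀‖ = ε` (`‖z₀‖ + ε < ρ'`), then `wind (H ∘ γ) ≠ 0` along
that circle (`helper_windNeZeroOfZero` applied to `z ↦ H (z + z₀)`). -/
theorem wind_circleLoop_ne_zero {H : ℂ → ℂ} {ρ' ε : ℝ} {z₀ : ℂ} (hε : 0 < ε)
    (hz₀ε : ‖z₀‖ + ε < ρ') (hH : DifferentiableOn ℂ H (ball 0 ρ')) (h0 : H z₀ = 0)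
    (hne : ∀ t ∈ Icc (0 : ℝ) 1, H (circleLoop z₀ ε t) ≠ 0) :
    wind (fun t => H (circleLoop z₀ ε t)) ≠ 0 := by
  have key : ∀ t, circleLoop 0 ε t + z₀ = circleLoop z₀ ε t := fun t => by
    rw [circleLoop_apply, circleLoop_apply]
    ring
  have hH₀ : DifferentiableOn ℂ (fun z => H (z + z₀)) (ball 0 (ρ' - ‖z₀‖)) :=
    hH.comp (differentiableOn_id.add_const z₀) fun z hz => by
      rw [mem_ball_zero_iff] at hz ⊢
      calc ‖z + z₀‖ ≤ ‖z‖ + ‖z₀‖ := norm_add_le _ _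
        _ < ρ' := by linarith
  have := helper_windNeZeroOfZero (fun z => H (z + z₀)) (ρ' - ‖z₀‖) ε hε (by linarith) hH₀ 0
    (by simpa using hε) (by simpa using h0) (fun t ht => by simpa only [key] using hne t ht)
  simpa only [key] using this

/-! ### The regularised family `h_t = e^{-s_t} w` and its holomorphic approximations -/

/-- **The approximation package.** With a cut-off `χ` (`= 1` on `‖z‖ ≤ ρ''`, vanishing off
`‖z‖ < ρ`, `‖χ‖ ≤ 1`), the localised coefficient `r̃ = χ r` satisfies `‖r̃‖ ≤ M ‖w‖` everywhere
and vanishes for `‖z‖ ≥ ρ`; for `t > 0` the regularised coefficient of `(w, r̃)` with `δ = t²`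
has a smooth potential `s` with `‖s‖ ≤ 4ρM ≤ S` on `‖z‖ ≤ ρ`, and `h = e^{-s} w` has
`‖∂̄ h‖ ≤ e^S M t / 2` on `‖z‖ ≤ ρ''`, hence is `C e^S M t / 2`-close on `‖z‖ ≤ ρ'` to a function
`H` holomorphic on `‖z‖ < ρ'`. -/
theorem exists_approx {w r χ : ℂ → ℂ} {M ρ ρ' ρ'' C S : ℝ} (hM : 0 ≤ M) (hρ : 0 ≤ ρ)
    (hρ'' : ρ'' ≤ ρ) (hS : 2 * (ρ + ρ) * M ≤ S)
    (hw : ContDiff ℝ ∞ w) (hr : ContDiff ℝ ∞ r) (hdbar : ∀ η, dbarAlong 1 w η = r η)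
    (hbound : ∀ η : ℂ, ‖η‖ ≤ ρ → ‖r η‖ ≤ M * ‖w η‖)
    (hχ : ContDiff ℝ ∞ χ) (hχ1 : ∀ z : ℂ, ‖z‖ ≤ ρ'' → χ z = 1)
    (hχ0 : ∀ z : ℂ, χ z ≠ 0 → ‖z‖ < ρ) (hχle : ∀ z : ℂ, ‖χ z‖ ≤ 1)
    (hC : ∀ (k : ℂ → ℂ) (ε : ℝ), ContDiff ℝ ∞ k → 0 ≤ ε →
      (∀ η : ℂ, ‖η‖ ≤ ρ'' → ‖dbarAlong 1 k η‖ ≤ ε) →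
      ∃ H : ℂ → ℂ, DifferentiableOn ℂ H (ball 0 ρ') ∧ ∀ η : ℂ, ‖η‖ ≤ ρ' → ‖k η - H η‖ ≤ C * ε)
    {t : ℝ} (ht : 0 < t) :
    ∃ s H : ℂ → ℂ, ContDiff ℝ ∞ s ∧ (∀ z : ℂ, ‖z‖ ≤ ρ → ‖s z‖ ≤ S) ∧
      DifferentiableOn ℂ H (ball 0 ρ') ∧
      ∀ z : ℂ, ‖z‖ ≤ ρ' → ‖Complex.exp (-s z) * w z - H z‖ ≤ C * (Real.exp S * (M * t / 2)) := by
  -- the localised coefficient `r̃ = χ r`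
  set r' : ℂ → ℂ := fun η => χ η * r η with hr'_def
  have hr' : ContDiff ℝ ∞ r' := hχ.mul hr
  have hsupp : ∀ η : ℂ, ρ ≤ ‖η‖ → r' η = 0 := fun η hη => by
    have hχη : χ η = 0 := by
      by_contra h
      exact (not_lt.2 hη) (hχ0 η h)
    simp [hr'_def, hχη]
  have hbound' : ∀ η, ‖r' η‖ ≤ M * ‖w η‖ := fun η => by
    by_cases hη : ‖η‖ ≤ ρ
    · calc ‖r' η‖ = ‖χ η‖ * ‖r η‖ := norm_mul _ _
        _ ≤ 1 * (M * ‖w η‖) := mul_le_mul (hχle η) (hbound η hη) (norm_nonneg _) zero_le_one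
        _ = M * ‖w η‖ := one_mul _
    · rw [hsupp η (not_le.1 hη).le, norm_zero]
      positivity
  -- the regularised coefficient with `δ = t²`
  obtain ⟨ha, hac, haM, har⟩ :=
    helper_regularisedCoefficient w r' M ρ (t ^ 2) hM (by positivity) hw hr' hbound' hsupp
  set a : ℂ → ℂ := fun η => r' η * (starRingEnd ℂ) (w η) / (((‖w η‖ ^ 2 + t ^ 2 : ℝ)) : ℂ)
    with ha_def
  have ha0 : ∀ η : ℂ, ρ ≤ ‖η‖ → a η = 0 := fun η hη => by simp [ha_def, hsupp η hη]
  have har' : ∀ η, ‖r' η - a η * w η‖ ≤ M * t / 2 := fun η => by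
    have := har η
    rwa [Real.sqrt_sq ht.le] at this
  -- the potential
  obtain ⟨s, hs, hds, hsS⟩ := exists_potential (ρ := ρ) hρ hρ hM ha hac haM ha0
  have hsS' : ∀ z : ℂ, ‖z‖ ≤ ρ → ‖s z‖ ≤ S := fun z hz => (hsS z hz).trans hS
  have hsd : Differentiable ℝ s := hs.differentiable (by simp)
  have hwd : Differentiable ℝ w := hw.differentiable (by simp)
  -- the modified function `h = e^{-s} w`
  set h : ℂ → ℂ := fun z => Complex.exp (-s z) * w z with hh_def
  have hh : ContDiff ℝ ∞ h := hs.neg.cexp.mul hw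
  have hdh : ∀ z : ℂ, ‖z‖ ≤ ρ'' → ‖dbarAlong 1 h z‖ ≤ Real.exp S * (M * t / 2) := by
    intro z hz
    have hrz : r z = r' z := by simp [hr'_def, hχ1 z hz]
    rw [hh_def, dbarAlong_one_exp_neg_mul (hsd z) (hwd z), hdbar z, hds z, norm_mul, hrz]
    exact mul_le_mul (norm_exp_neg_le (hsS' z (by linarith))) (har' z) (norm_nonneg _)
      (Real.exp_pos S).le
  obtain ⟨H, hH, hHh⟩ := hC h (Real.exp S * (M * t / 2)) hh (by positivity) hdh
  exact ⟨s, H, hs, hsS', hH, hHh⟩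

/-! ### Rouché transfer along a small circle around `z₀` -/

/-- **Rouché transfer.** Let `γ` be the circle `‖z - z₀‖ = ε` inside the disc `‖z‖ < ρ'`, let
`H_k → H` locally uniformly on the disc with `‖e^{-s_k} w - H_k‖ ≤ e_k → 0` on `‖z‖ ≤ ρ'`, and
suppose `w` and `H` have no zero on the circle. Then `wind (w ∘ γ) = wind (H ∘ γ)`: for `k`
large `e^{-s_k ∘ γ} (w ∘ γ)` is Rouché-close to `H ∘ γ`, and the exponential factor (the
exponential of a periodic function) does not wind. -/
theorem wind_eq_of_approx {w Hlim : ℂ → ℂ} {Hk sk : ℕ → ℂ → ℂ} {e : ℕ → ℝ} {ρ' ε : ℝ} {z₀ : ℂ}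
    (hε : 0 < ε) (hz₀ε : ‖z₀‖ + ε < ρ') (hw : Continuous w) (hs : ∀ k, Continuous (sk k))
    (hHlim : DifferentiableOn ℂ Hlim (ball 0 ρ'))
    (hlim : TendstoLocallyUniformlyOn Hk Hlim atTop (ball 0 ρ'))
    (happ : ∀ k (z : ℂ), ‖z‖ ≤ ρ' → ‖Complex.exp (-sk k z) * w z - Hk k z‖ ≤ e k)
    (he : Tendsto e atTop (𝓝 0)) (hw0 : ∀ z : ℂ, ‖z - z₀‖ = ε → w z ≠ 0)
    (hH0 : ∀ z : ℂ, ‖z - z₀‖ = ε → Hlim z ≠ 0) :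
    wind (fun t => w (circleLoop z₀ ε t)) = wind (fun t => Hlim (circleLoop z₀ ε t)) := by
  -- the closed disc `‖z - z₀‖ ≤ ε` lies in the open disc `‖z‖ < ρ'`
  have hdisc : ∀ z : ℂ, ‖z - z₀‖ ≤ ε → ‖z‖ < ρ' := fun z hz => by
    have := norm_le_insert' z z₀
    linarith
  have hγ : ∀ t, ‖circleLoop z₀ ε t - z₀‖ = ε := fun t => by
    rw [norm_circleLoop_sub_center, abs_of_pos hε]
  have hγρ : ∀ t, ‖circleLoop z₀ ε t‖ < ρ' := fun t => hdisc _ (hγ t).le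
  -- a positive lower bound `m` for `‖Hlim‖` on the circle
  obtain ⟨m, hm0, hm⟩ : ∃ m : ℝ, 0 < m ∧ ∀ z : ℂ, ‖z - z₀‖ = ε → m ≤ ‖Hlim z‖ := by
    have hsub : sphere z₀ ε ⊆ ball 0 ρ' := fun z hz =>
      mem_ball_zero_iff.2 (hdisc z (mem_sphere_iff_norm.1 hz).le)
    obtain ⟨z₂, hz₂, hmin⟩ := (isCompact_sphere z₀ ε).exists_isMinOn
      ⟨z₀ + ε, by simp [mem_sphere_iff_norm, hε.le]⟩ (hHlim.continuousOn.mono hsub).norm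
    exact ⟨‖Hlim z₂‖, norm_pos_iff.2 (hH0 z₂ (mem_sphere_iff_norm.1 hz₂)), fun z hz =>
      hmin (mem_sphere_iff_norm.2 hz)⟩
  -- uniform convergence on the closed disc, and smallness of the error, for `k` large
  have hK : closedBall z₀ ε ⊆ ball 0 ρ' := fun z hz =>
    mem_ball_zero_iff.2 (hdisc z (mem_closedBall_iff_norm.1 hz))
  have hunif := (tendstoLocallyUniformlyOn_iff_forall_isCompact isOpen_ball).1 hlim
    (closedBall z₀ ε) hK (isCompact_closedBall z₀ ε)
  have hev1 : ∀ᶠ k in atTop, ∀ z ∈ closedBall z₀ ε, dist (Hlim z) (Hk k z) < m / 4 :=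
    Metric.tendstoUniformlyOn_iff.1 hunif (m / 4) (by positivity)
  have hev2 : ∀ᶠ k in atTop, e k < m / 4 := he.eventually (gt_mem_nhds (by positivity))
  obtain ⟨k, hk1, hk2⟩ := (hev1.and hev2).exists
  -- the loops along the circle
  have hHl : IsNonvanishingLoop (fun t => Hlim (circleLoop z₀ ε t)) :=
    ⟨hHlim.continuousOn.comp (continuous_circleLoop z₀ ε).continuousOn fun t _ =>
      mem_ball_zero_iff.2 (hγρ t), fun t _ => hH0 _ (hγ t), by rw [circleLoop_zero_eq]⟩
  have hwl : IsNonvanishingLoop (fun t => w (circleLoop z₀ ε t)) :=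
    ⟨(hw.comp (continuous_circleLoop z₀ ε)).continuousOn, fun t _ => hw0 _ (hγ t),
      by rw [circleLoop_zero_eq]⟩
  have hEl : IsNonvanishingLoop (fun t => Complex.exp (-sk k (circleLoop z₀ ε t))) :=
    ⟨(((hs k).comp (continuous_circleLoop z₀ ε)).neg.cexp).continuousOn,
      fun t _ => Complex.exp_ne_zero _, by rw [circleLoop_zero_eq]⟩
  have hEw : wind (fun t => Complex.exp (-sk k (circleLoop z₀ ε t))) = 0 :=
    wind_exp_eq_zero (l := fun t => -sk k (circleLoop z₀ ε t))
      (((hs k).comp (continuous_circleLoop z₀ ε)).neg).continuousOn (by rw [circleLoop_zero_eq])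
  -- Rouché: `h_k ∘ γ` against `Hlim ∘ γ`
  have hrouche : wind (fun t => Complex.exp (-sk k (circleLoop z₀ ε t)) * w (circleLoop z₀ ε t)) =
      wind (fun t => Hlim (circleLoop z₀ ε t)) := by
    refine wind_eq_of_norm_sub_lt (hEl.mul hwl).continuousOn (hEl.mul hwl).eq_endpoints hHl
      fun t _ => ?_
    have h1 := happ k (circleLoop z₀ ε t) (hγρ t).le
    have h2 := hk1 (circleLoop z₀ ε t) (mem_closedBall_iff_norm.2 (hγ t).le)
    rw [dist_eq_norm, norm_sub_rev] at h2
    have h3 := hm _ (hγ t)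
    calc ‖Complex.exp (-sk k (circleLoop z₀ ε t)) * w (circleLoop z₀ ε t) -
          Hlim (circleLoop z₀ ε t)‖
        ≤ ‖Complex.exp (-sk k (circleLoop z₀ ε t)) * w (circleLoop z₀ ε t) -
            Hk k (circleLoop z₀ ε t)‖ +
          ‖Hk k (circleLoop z₀ ε t) - Hlim (circleLoop z₀ ε t)‖ :=
          norm_sub_le_norm_sub_add_norm_sub _ _ _
      _ < m := by linarith
      _ ≤ ‖Hlim (circleLoop z₀ ε t)‖ := h3
  rw [← hrouche, wind_mul hEl hwl, hEw, zero_add]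

end LocalZeroIsolatedPositive

open LocalZeroIsolatedPositive ZeroFreeOfDbarLe in
/-- (S2) local consequences of the similarity principle: a smooth `w` with `|∂̄ w| ≤ M |w|` on a
disc, vanishing at an interior point but not identically on the disc, has a small zero-free
punctured disc around that point on whose boundary circle its winding number is non-zero. -/
theorem helper_localZeroIsolatedPositive (w r : ℂ → ℂ) (M ρ : ℝ) (hρ : 0 < ρ)
    (hw : ContDiff ℝ ∞ w) (hr : ContDiff ℝ ∞ r)
    (hdbar : ∀ η : ℂ, Literature.Analysis.Complex.dbarAlong 1 w η = r η)
    (hbound : ∀ η : ℂ, ‖η‖ ≤ ρ → ‖r η‖ ≤ M * ‖w η‖)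
    (z₀ : ℂ) (hz₀ : ‖z₀‖ < ρ) (h0 : w z₀ = 0) (hne : ∃ z : ℂ, ‖z‖ < ρ ∧ w z ≠ 0) :
    ∃ ε : ℝ, 0 < ε ∧ ‖z₀‖ + ε < ρ ∧
      (∀ z : ℂ, 0 < ‖z - z₀‖ → ‖z - z₀‖ ≤ ε → w z ≠ 0) ∧
      Literature.Topology.PlaneTopology.wind
        (fun t => w (Literature.Topology.PlaneTopology.circleLoop z₀ ε t)) ≠ 0 := by
  obtain ⟨z₁, hz₁, h1⟩ := hne
  -- `0 ≤ M`, tested at the point `z₁` where `w ≠ 0`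
  have hM : 0 ≤ M :=
    nonneg_of_mul_nonneg_left ((norm_nonneg _).trans (hbound z₁ hz₁.le)) (norm_pos_iff.2 h1)
  -- radii `max ‖z₀‖ ‖z₁‖ < ρ' < ρ'' < ρ`
  obtain ⟨ρ', hz₀', hz₁', hρ'⟩ : ∃ ρ' : ℝ, ‖z₀‖ < ρ' ∧ ‖z₁‖ < ρ' ∧ ρ' < ρ :=
    ⟨(max ‖z₀‖ ‖z₁‖ + ρ) / 2, by have := le_max_left ‖z₀‖ ‖z₁‖; linarith [max_lt hz₀ hz₁],
      by have := le_max_right ‖z₀‖ ‖z₁‖; linarith [max_lt hz₀ hz₁], by linarith [max_lt hz₀ hz₁]⟩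
  have hρ'0 : 0 < ρ' := (norm_nonneg _).trans_lt hz₀'
  obtain ⟨C, hC0, hC⟩ := helper_approxHolomorphic ρ' ((ρ' + ρ) / 2) hρ'0 (by linarith)
  obtain ⟨χ, hχ, -, hχ1, hχ0, hχle⟩ :=
    ApproxHolomorphic.exists_cutoff (ρm := (ρ' + ρ) / 2) (ρ := ρ) (by linarith) (by linarith)
  -- the regularised family along `t = 1 / (n + 1)` and its holomorphic approximations
  set S : ℝ := 2 * (ρ + ρ) * M with hS_def
  have key : ∀ n : ℕ, ∃ s H : ℂ → ℂ, ContDiff ℝ ∞ s ∧ (∀ z : ℂ, ‖z‖ ≤ ρ → ‖s z‖ ≤ S) ∧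
      DifferentiableOn ℂ H (ball 0 ρ') ∧
      ∀ z : ℂ, ‖z‖ ≤ ρ' → ‖Complex.exp (-s z) * w z - H z‖ ≤
        C * (Real.exp S * (M * (1 / ((n : ℝ) + 1)) / 2)) := fun n =>
    exists_approx hM hρ.le (by linarith) le_rfl hw hr hdbar hbound hχ hχ1 hχ0 hχle hC
      (by positivity)
  choose s H hs hsS hH happ using key
  -- Montel: a locally uniformly convergent subsequence with holomorphic limit `Hlim`
  obtain ⟨W, hW⟩ := (isCompact_closedBall (0 : ℂ) ρ').exists_bound_of_continuousOn
    hw.continuous.continuousOn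
  have hB : ∀ n, ∀ z ∈ ball (0 : ℂ) ρ', ‖H n z‖ ≤ Real.exp S * W + C * (Real.exp S * M) := by
    intro n z hz
    have hz' : ‖z‖ ≤ ρ' := (mem_ball_zero_iff.1 hz).le
    have h1 := happ n z hz'
    have h2 : ‖Complex.exp (-s n z) * w z‖ ≤ Real.exp S * W := by
      rw [norm_mul]
      exact mul_le_mul (norm_exp_neg_le (hsS n z (by linarith)))
        (hW z (mem_closedBall_zero_iff.2 hz')) (norm_nonneg _) (Real.exp_pos S).le
    have h3 : C * (Real.exp S * (M * (1 / ((n : ℝ) + 1)) / 2)) ≤ C * (Real.exp S * M) := by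
      refine mul_le_mul_of_nonneg_left (mul_le_mul_of_nonneg_left ?_ (Real.exp_pos S).le) hC0
      have : 1 / ((n : ℝ) + 1) ≤ 1 := by
        rw [div_le_one (by positivity)]
        linarith [n.cast_nonneg (α := ℝ)]
      nlinarith
    have h4 := norm_le_insert (Complex.exp (-s n z) * w z) (H n z)
    linarith
  obtain ⟨Hlim, φ, hφ, hHlim, hloc, -⟩ :=
    Complex.exists_strictMono_tendstoLocallyUniformlyOn_of_norm_le isOpen_ball hH hB
  -- the errors along the subsequence tend to `0`
  set e : ℕ → ℝ := fun k => C * (Real.exp S * (M * (1 / ((φ k : ℝ) + 1)) / 2)) with he_def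
  have he : Tendsto e atTop (𝓝 0) := by
    have h1 : Tendsto (fun k => 1 / ((φ k : ℝ) + 1)) atTop (𝓝 0) :=
      (tendsto_one_div_add_atTop_nhds_zero_nat (𝕜 := ℝ)).comp hφ.tendsto_atTop
    have h2 := h1.const_mul (C * Real.exp S * M / 2)
    rw [mul_zero] at h2
    have h3 : e = fun k => C * Real.exp S * M / 2 * (1 / ((φ k : ℝ) + 1)) :=
      funext fun k => by rw [he_def]; ring
    rw [h3]
    exact h2
  -- the two-sided comparison `e^{-S} ‖w‖ ≤ ‖Hlim‖ ≤ e^S ‖w‖` on the disc `‖z‖ < ρ'`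
  have hcomp : ∀ z : ℂ, ‖z‖ < ρ' →
      Real.exp (-S) * ‖w z‖ ≤ ‖Hlim z‖ ∧ ‖Hlim z‖ ≤ Real.exp S * ‖w z‖ := by
    intro z hz
    refine norm_le_of_tendsto (v := fun k => Complex.exp (-s (φ k) z) * w z)
      (hloc.tendsto_at (mem_ball_zero_iff.2 hz)) he (fun k => happ (φ k) z hz.le)
      (fun k => ?_) (fun k => ?_)
    · rw [norm_mul]
      exact mul_le_mul_of_nonneg_right (exp_neg_le_norm_exp_neg (hsS _ z (by linarith)))
        (norm_nonneg _)
    · rw [norm_mul]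
      exact mul_le_mul_of_nonneg_right (norm_exp_neg_le (hsS _ z (by linarith))) (norm_nonneg _)
  have hHlim0 : Hlim z₀ = 0 := by
    have := (hcomp z₀ hz₀').2
    rw [h0, norm_zero, mul_zero] at this
    exact norm_le_zero_iff.1 this
  have hHlim1 : Hlim z₁ ≠ 0 := fun h => by
    have h2 := (hcomp z₁ hz₁').1
    rw [h, norm_zero] at h2
    have h3 : 0 < Real.exp (-S) * ‖w z₁‖ := mul_pos (Real.exp_pos _) (norm_pos_iff.2 h1)
    linarith
  -- the zero-free punctured disc
  obtain ⟨ε, hε, hε', hHne⟩ := exists_radius hHlim hz₀' hz₁' hHlim1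
  have hwne : ∀ z : ℂ, 0 < ‖z - z₀‖ → ‖z - z₀‖ ≤ ε → w z ≠ 0 := fun z hz1 hz2 hwz => by
    have hz : ‖z‖ < ρ' := by
      have := norm_le_insert' z z₀
      linarith
    have h2 := (hcomp z hz).2
    rw [hwz, norm_zero, mul_zero] at h2
    exact hHne z hz1 hz2 (norm_le_zero_iff.1 h2)
  refine ⟨ε, hε, by linarith, hwne, ?_⟩
  -- the winding number
  have hH0' : ∀ z : ℂ, ‖z - z₀‖ = ε → Hlim z ≠ 0 := fun z hz =>
    hHne z (by rw [hz]; exact hε) hz.le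
  have hw0' : ∀ z : ℂ, ‖z - z₀‖ = ε → w z ≠ 0 := fun z hz => hwne z (by rw [hz]; exact hε) hz.le
  rw [wind_eq_of_approx hε hε' hw.continuous (fun k => (hs (φ k)).continuous) hHlim hloc
    (fun k z hz => happ (φ k) z hz) he hw0' hH0']
  exact wind_circleLoop_ne_zero hε hε' hHlim hHlim0 fun t _ =>
    hH0' _ (by rw [norm_circleLoop_sub_center, abs_of_pos hε])

end Summit.SmoothPoincare4.SmoothPoincare4.Cruxes.TameOrBrodyR4.Sketch

end
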